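import Summits.QuantumFields.BalabanUV.T4Continuum.Support.TorusColumnsTwoLevel
import Summits.QuantumFields.BalabanUV.T4Continuum.Support.GradedWellGramPairing
import Summits.QuantumFields.BalabanUV.T4Continuum.Support.GradedWellResolventTower
import Summits.QuantumFields.BalabanUV.T4Continuum.Support.GradedWellScalarCoercive

/-!
# T⁴ programme, spine node NE2 (U1a), sub-row Δ1 — THE GRADED WELL, leaf (GW-B) part 2: THE GRADED-WELL INSTANCE `hB`
# `‖B_{k+1} ∘ rowSLift − J_k·B_k‖ ≤ Cb_GW·L^{−k}` — the two-level law of the gauge columns `B_k = ∂·G′_GW·Q′ₙᴴ` at the TORUS rate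

Cell `pub-balaban-gaps` (YM blitz, track G2, seat ne2 = spine estimate NE2), continuing the parked NE2 formalisation lineage
(`t4/SKELETON-NE2-P1.md` v0.13 §2D «Δ1 VECTOR — THE GRADED WELL», `t4/T4-EST-NE2-D1-GW-SPEC.md` v1.1 §5: the END of record
`GradedWellSandwichLaw.towerLimitRate_GW_of_GWB` holds modulo `hco` ✓, `hE` ✓, `hMc` = (E4) and **`hB` = (GW-B)**).  Part 1 (owner item O17-b,
`TorusColumnsTwoLevel.opNorm_columns_twoLevel_le`) is the «H⁻¹ route» on the torus for an ABSTRACT massive pair `D = ∂ᴴ∂ + W`, `D′ = ∂′ᴴ∂′ + W′`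
with `W′J₀ = J₀W`.  THIS FILE is the graded-well instance:
 * §1 the graded scalar mass `WGW := a′·Q′_wᴴQ′_w`: `DpGW_eq_lap_add_WGW` (`Δ′_GW = ∂ᴴ∂ + W_GW`, B5 (1.21)'s `∂ᴴ∂ = −Δ`), the EXACT intertwining
   `WGW_succ_mul_J0` (leaf-05-g10's `GradedWellGramPairing.QwHQw_succ_mul_J0`), positivity `re_form_WGW_nonneg`, the level-free size
   `opNorm_WGW_le : ‖W_GW‖ ≤ a′·L^{2m}`;
 * §2 the dual pairing of the NORMALISED rows `J0_mul_QsGWn_conjTranspose : J₀·Q′ₙ(k)ᴴ = (Q′ₙ(k+1) ∘ rowSLift)ᴴ` (the planted normalised indicator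
   IS the lifted one), `‖Q′ₙᴴ‖ ≤ 1`, and the factorisation `BhGWL_eq : B_{k+1} ∘ rowSLift = ∂′·G′_GW(k+1)·J₀·Q′ₙ(k)ᴴ`;
 * §3 **`hB_GW (hk : m ≤ k) (hlay : layer ≤ m) (ha′ : 0 < a′) : ‖BhGWL k hk − JGW k·BhGW k‖ ≤ CbGW d L m a′·(L⁻¹)^k`** with the LEVEL-FREE constant
   `CbGW = Ccol d L γ_GW⁻¹ γ_GW⁻¹ (a′L^{2m}) (a′L^{2m})`, and `hB_GW_of_le` (any `θ ≥ L⁻¹`) — the `hB` binder of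
   `GradedWellSandwichLaw.towerLimitRate_GW_of_GWB` / `GradedWellResolventTower.hinjK_GW_of_local` BY NAME.  Rate `L⁻¹`, no wall, no trace.

HONEST FRAMING (T4-DAG p. 1).  [folklore] bookkeeping over landed modules at MODEL level (`U = 1`, one layer map on unit blocks, `m` fixed, finite
torus, operator norm); statements and constants OURS; nothing of Bałaban's certified or disputed; (E4) (`hMc`) remains displayed in the END until
`GradedWellMassCommutator` lands; NE2 (U1a) NOT proved; spine PROVED 0/9 unchanged; NOT [B9] (3.16)/(3.23)–(3.27)/(3.42) as printed; NOT continuum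
YM, NOT infinite volume / mass gap / Clay.  HONEST DEPENDENCY: continuum YM on T⁴ ⇐ BetaPertH ∧ nine spine estimates (0/9 proved); BetaPertH ⇐ (D1) ∧
(D4) ∧ CAP+tail; G-an2-4 gates asym, D1 and NE2/3/4.  No `sorry`, no `def … : Prop`.
-/

noncomputable section

open scoped BigOperators ComplexConjugate Matrix Matrix.Norms.L2Operator

namespace Summit.QuantumFields.BalabanUV.T4Continuum.GradedWellColumnsTwoLevel

open Literature.MathematicalPhysics.QuantumFieldTheory.Balaban1983to89.B5Prop11Plancherel (Tor fine)
open Literature.MathematicalPhysics.QuantumFieldTheory.Balaban1983to89.B5Action121 (GradOp LapS GradOp_conjTranspose_mul_GradOp)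
open Literature.MathematicalPhysics.QuantumFieldTheory.Balaban1983to89.B5G183RateUnitTower (lev lev_neZero)
open Literature.MathematicalPhysics.QuantumFieldTheory.Balaban1983to89.B5Prop11Lower (nsq nsq_nonneg)
open Literature.MathematicalPhysics.QuantumFieldTheory.Balaban1983to89.B5G183RateTorus (cpt)
open Summit.QuantumFields.BalabanUV.T4Continuum
open Summit.QuantumFields.BalabanUV.T4Continuum.ScalarBlockPlanting (JK0)
open Summit.QuantumFields.BalabanUV.T4Continuum.ScalarPlantingDefect (J0pcT opNorm_J0pcT_le)
open Summit.QuantumFields.BalabanUV.T4Continuum.BalabanAveragedTowerModes (par)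
open Summit.QuantumFields.BalabanUV.T4Continuum.GradedSubBlocks (Anchor Anc InSub meanS)
open Summit.QuantumFields.BalabanUV.T4Continuum.GradedWellData
open Summit.QuantumFields.BalabanUV.T4Continuum.GradedWellSlice (QsGWn QsGWn_mul_conjTranspose)
open Summit.QuantumFields.BalabanUV.T4Continuum.GradedWellTwoLevel (sGW_succ anchor_lift rowSLift BhGW BhGWL)
open Summit.QuantumFields.BalabanUV.T4Continuum.GradedWellGramPairing (inSub_cpt_iff J0_mul_apply QwHQw_succ_mul_J0 nsq_QsGWw_le
  nsq_QsGWnH_mulVec)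
open Summit.QuantumFields.BalabanUV.T4Continuum.GradedWellResolventTower (JGW)
open Summit.QuantumFields.BalabanUV.T4Continuum.GradedWellScalarCoercive (gamGW gamGW_pos isUnit_det_DpGW opNorm_GOmGW_le)

variable {d : ℕ} (L : ℕ) [NeZero L] (M : Fin d → ℕ) [hM : ∀ μ, NeZero (M μ)] (k m : ℕ) (layer : Tor M → ℕ) (a' : ℝ)

/-! ## §1 The graded scalar mass `W_GW = a′·Q′_wᴴQ′_w`: the splitting `Δ′_GW = ∂ᴴ∂ + W_GW`, exact intertwining, positivity, size -/

/-- **THE GRADED SCALAR MASS** `W_GW := a′·Q′_wᴴQ′_w` (the mass term of `Δ′_GW`). [cite: Balaban1985BackgroundPropagators, (3.24) p.394 (shape: `Q′*aQ′`)] [folklore] -/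
def WGW : Matrix (TorK L M k) (TorK L M k) ℂ := (a' : ℂ) • ((QsGWw L M k m layer)ᴴ * QsGWw L M k m layer)

/-- `Δ′_GW = ∂ᴴ∂ + W_GW`. [folklore] -/
theorem DpGW_eq_lap_add_WGW : DpGW L M k m layer a' = (gradT L M k)ᴴ * gradT L M k + WGW L M k m layer a' := by
  unfold DpGW WGW
  rw [GradOp_conjTranspose_mul_GradOp]

/-- **exact intertwining with King's scalar planting**: `W_GW(k+1)·J₀ = J₀·W_GW(k)` (`m ≤ k`). [folklore] -/
theorem WGW_succ_mul_J0 (hk : m ≤ k) :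
    WGW L M (k + 1) m layer a' * J0pcT L M k = J0pcT L M k * WGW L M k m layer a' := by
  unfold WGW
  rw [Matrix.smul_mul, Matrix.mul_smul, QwHQw_succ_mul_J0 L M k m layer hk]

/-- `W_GW ⪰ 0` for `0 ≤ a′`. [folklore] -/
theorem re_form_WGW_nonneg (ha' : 0 ≤ a') (v : TorK L M k → ℂ) : 0 ≤ (star v ⬝ᵥ (WGW L M k m layer a' *ᵥ v)).re := by
  unfold WGW
  rw [Matrix.smul_mulVec, dotProduct_smul, RegionGaugeSlice.form_gram, smul_eq_mul, ← Complex.ofReal_mul, Complex.ofReal_re]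
  exact mul_nonneg ha' (nsq_nonneg _)

/-- `‖Q′_wᴴQ′_w‖ ≤ L^{2m}`. [folklore] -/
theorem opNorm_QwHQw_le : ‖(QsGWw L M k m layer)ᴴ * QsGWw L M k m layer‖ ≤ ((L : ℝ) ^ m) ^ 2 := by
  refine ScalarAveragedPropagator.opNorm_le_of_nsq_le_rect _ (by positivity) fun x => ?_
  rw [← Matrix.mulVec_mulVec]
  calc nsq ((QsGWw L M k m layer)ᴴ *ᵥ (QsGWw L M k m layer *ᵥ x))
      ≤ ((L : ℝ) ^ m) ^ 2 * nsq (QsGWw L M k m layer *ᵥ x) := (nsq_QsGWw_le L M k m layer x _).2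
    _ ≤ ((L : ℝ) ^ m) ^ 2 * (((L : ℝ) ^ m) ^ 2 * nsq x) :=
        mul_le_mul_of_nonneg_left (nsq_QsGWw_le L M k m layer x (QsGWw L M k m layer *ᵥ x)).1 (by positivity)
    _ = (((L : ℝ) ^ m) ^ 2) ^ 2 * nsq x := by ring

/-- the level-free size of the graded scalar mass: `w_GW = a′·L^{2m}`. [folklore] -/
def wGWc (L m : ℕ) (a' : ℝ) : ℝ := a' * ((L : ℝ) ^ m) ^ 2

omit [NeZero L] hM in
/-- `0 ≤ w_GW` for `0 ≤ a′`. [folklore] -/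
theorem wGWc_nonneg (ha' : 0 ≤ a') : 0 ≤ wGWc L m a' := mul_nonneg ha' (by positivity)

/-- **`‖W_GW‖ ≤ a′·L^{2m}`** — level-free. [folklore] -/
theorem opNorm_WGW_le (ha' : 0 ≤ a') : ‖WGW L M k m layer a'‖ ≤ wGWc L m a' := by
  unfold WGW wGWc
  rw [norm_smul, Complex.norm_real, Real.norm_of_nonneg ha']
  exact mul_le_mul_of_nonneg_left (opNorm_QwHQw_le L M k m layer) ha'

/-! ## §2 The dual pairing of the NORMALISED rows: `J₀·Q′ₙ(k)ᴴ = (Q′ₙ(k+1) ∘ rowSLift)ᴴ` -/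

/-- **the lifted normalised indicator IS the planted one**: `J₀·Q′ₙ(k)ᴴ = (Q′ₙ(k+1) ∘ rowSLift)ᴴ`
(`√(L^d)·L^{−d}·(√(s^d))⁻¹ = (√((Ls)^d))⁻¹`). [folklore] -/
theorem J0_mul_QsGWn_conjTranspose (hk : m ≤ k) :
    J0pcT L M k * (QsGWn L M k m layer)ᴴ = ((QsGWn L M (k + 1) m layer).submatrix (rowSLift L M k m layer hk) id)ᴴ := by
  ext x' p
  have hi : (p.1.1 : ℕ) ≤ k := le_trans (Nat.le_of_lt_succ p.1.1.isLt) hk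
  rw [J0_mul_apply, Matrix.conjTranspose_apply, Matrix.conjTranspose_apply, Matrix.submatrix_apply]
  show _ = star (((Real.sqrt ((((sGW L (k + 1) p.1.1 : ℕ) : ℝ)) ^ d) : ℝ) : ℂ) *
    meanS (fine (lev L (k + 1)) M) (sGW L (k + 1) p.1.1) ⟨cpt (lev L k) L M p.1.2.1, anchor_lift L M k hi p.1.2.2⟩ x')
  simp only [QsGWn, QsGW, meanS]
  by_cases h : InSub (fine (lev L k) M) (sGW L k p.1.1) p.1.2.1 (par (lev L k) L M x')
  · rw [if_pos h, if_pos ((inSub_cpt_iff L M k hi p.1.2.1 x').mpr h), sGW_succ L k hi]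
    have hL : (0 : ℝ) < (L : ℝ) ^ d := pow_pos (by exact_mod_cast Nat.pos_of_ne_zero (NeZero.ne L)) d
    have hsq : Real.sqrt (((L * sGW L k p.1.1 : ℕ) : ℝ) ^ d) = Real.sqrt ((L : ℝ) ^ d) * Real.sqrt (((sGW L k p.1.1 : ℕ) : ℝ) ^ d) := by
      rw [Nat.cast_mul, mul_pow, Real.sqrt_mul hL.le]
    rw [hsq]
    simp only [star_mul', Complex.star_def, Complex.conj_ofReal, map_inv₀, map_pow, Complex.conj_natCast]
    push_cast
    simp only [mul_pow, mul_inv]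
    ring
  · rw [if_neg h, if_neg fun h' => h ((inSub_cpt_iff L M k hi p.1.2.1 x').mp h')]
    simp

/-- `‖Q′ₙᴴ‖ ≤ 1` (orthonormal rows). [folklore] -/
theorem opNorm_QsGWn_conjTranspose_le : ‖(QsGWn L M k m layer)ᴴ‖ ≤ 1 :=
  ScalarAveragedPropagator.opNorm_le_of_nsq_le_rect _ zero_le_one fun u => by
    rw [nsq_QsGWnH_mulVec, one_pow, one_mul]

/-- **THE GAUGE COLUMNS FACTOR THROUGH THE PLANTED ROWS**: `BhGWL = ∂′·G′_GW(k+1)·J₀·Q′ₙ(k)ᴴ`. [folklore] -/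
theorem BhGWL_eq (hk : m ≤ k) :
    BhGWL L M k m layer a' hk
      = gradT L M (k + 1) * GOmGW L M (k + 1) m layer a' * J0pcT L M k * (QsGWn L M k m layer)ᴴ := by
  rw [Matrix.mul_assoc _ (J0pcT L M k), J0_mul_QsGWn_conjTranspose L M k m layer hk, Matrix.conjTranspose_submatrix]
  unfold BhGWL BhGW RegionGaugeResolventSplit.gaugeB
  rw [Matrix.submatrix_mul _ _ _ _ _ Function.bijective_id, Matrix.submatrix_id_id]

/-- `BhGW = ∂·G′_GW·Q′ₙᴴ` (unfolding). [folklore] -/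
theorem BhGW_eq : BhGW L M k m layer a' = gradT L M k * GOmGW L M k m layer a' * (QsGWn L M k m layer)ᴴ := rfl

omit [NeZero L] hM in
/-- the level-`k+1` gradient in the `(L·N)`-spelling of `TorusColumnsTwoLevel`. [folklore] -/
theorem gradT_succ : gradT L M (k + 1) = GradOp (fine (L * lev L k) M) ((L : ℂ) * ((lev L k : ℕ) : ℂ)) := by
  show GradOp (fine (L * lev L k) M) (((L * lev L k : ℕ)) : ℂ) = _
  rw [Nat.cast_mul]


/-! ## §3 (GW-B): THE TWO-LEVEL LAW OF THE GAUGE COLUMNS OF THE GRADED WELL at the torus rate `L⁻¹` -/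

section Main

open Summit.QuantumFields.BalabanUV.T4Continuum.TorusColumnsTwoLevel (Ccol Ccol_nonneg opNorm_columns_twoLevel_le)

/-- **THE (GW-B) CONSTANT** `Cb_GW := Ccol d L γ_GW⁻¹ γ_GW⁻¹ (a′L^{2m}) (a′L^{2m})` — depends on `d, L, m, a′` only (LEVEL-FREE). [folklore] -/
def CbGW (d L m : ℕ) (a' : ℝ) : ℝ :=
  Ccol d L ((gamGW d m a')⁻¹) ((gamGW d m a')⁻¹) (wGWc L m a') (wGWc L m a')

omit [NeZero L] hM in
/-- `0 ≤ Cb_GW`. [folklore] -/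
theorem CbGW_nonneg (ha' : 0 < a') : 0 ≤ CbGW d L m a' :=
  Ccol_nonneg L (inv_nonneg.mpr (gamGW_pos (d := d) (m := m) a' ha').le) (wGWc_nonneg L m a' ha'.le)
    (wGWc_nonneg L m a' ha'.le)

omit [NeZero L] hM in
/-- `(n_k)⁻¹ = (L⁻¹)^k`. [folklore] -/
theorem inv_lev_eq (k : ℕ) : (((lev L k : ℕ) : ℝ))⁻¹ = ((L : ℝ)⁻¹) ^ k := by
  rw [lev_eq_pow, Nat.cast_pow, inv_pow]

/-- **(GW-B) — THE TWO-LEVEL LAW OF THE GAUGE COLUMNS OF THE GRADED WELL** (`m ≤ k`, `layer ≤ m`, `0 < a′`):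
`‖B_{k+1} ∘ rowSLift − J_k·B_k‖ ≤ Cb_GW·L^{−k}` — the `hB` binder of `GradedWellSandwichLaw.towerLimitRate_GW_of_GWB` /
`GradedWellResolventTower.hinjK_GW_of_local` BY NAME, at the TORUS rate (no wall, no trace): the H⁻¹ route of
`TorusColumnsTwoLevel.opNorm_columns_twoLevel_le` for the pair `D = Δ′_GW(k) = ∂ᴴ∂ + W_GW(k)`, `D′ = Δ′_GW(k+1)` whose masses intertwine
EXACTLY (`WGW_succ_mul_J0`), times the planted normalised rows (`BhGWL_eq`, `‖Q′ₙᴴ‖ ≤ 1`).  Model level (U = 1, one layer map on unit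
blocks, `m` fixed, finite torus, operator norm); NE2 (U1a) NOT proved by this. [cite: King1986, Lemma 4.5 (4.38) p.674 (shape: two-level rate L^{−k})] [folklore] -/
theorem hB_GW (hk : m ≤ k) (hlay : ∀ y, layer y ≤ m) (ha' : 0 < a') :
    ‖BhGWL L M k m layer a' hk - JGW L M k * BhGW L M k m layer a'‖ ≤ CbGW d L m a' * ((L : ℝ)⁻¹) ^ k := by
  have hD : IsUnit (DpGW L M k m layer a').det := isUnit_det_DpGW L M k m layer a' hlay ha'
  have hD' : IsUnit (DpGW L M (k + 1) m layer a').det := isUnit_det_DpGW L M (k + 1) m layer a' hlay ha'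
  have hg0 : 0 ≤ (gamGW d m a')⁻¹ := inv_nonneg.mpr (gamGW_pos (d := d) (m := m) a' ha').le
  have hw0 : 0 ≤ wGWc L m a' := wGWc_nonneg L m a' ha'.le
  have hGn : ‖GOmGW L M k m layer a'‖ ≤ (gamGW d m a')⁻¹ := opNorm_GOmGW_le L M k m layer a' hlay ha'
  have hG'n : ‖GOmGW L M (k + 1) m layer a'‖ ≤ (gamGW d m a')⁻¹ := opNorm_GOmGW_le L M (k + 1) m layer a' hlay ha'
  have hWn := opNorm_WGW_le L M k m layer a' ha'.le
  have hW'n := opNorm_WGW_le L M (k + 1) m layer a' ha'.le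
  -- the level-`k+1` data in the `(L·N)`-spelling of `TorusColumnsTwoLevel` (same terms, index types unfolded)
  let W' : Matrix (Tor (fine (L * lev L k) M)) (Tor (fine (L * lev L k) M)) ℂ := WGW L M (k + 1) m layer a'
  let G' : Matrix (Tor (fine (L * lev L k) M)) (Tor (fine (L * lev L k) M)) ℂ := GOmGW L M (k + 1) m layer a'
  have hWJ : W' * JK0 (lev L k) L M = JK0 (lev L k) L M * WGW L M k m layer a' :=
    WGW_succ_mul_J0 L M k m layer a' hk
  have hWpos0 := re_form_WGW_nonneg L M k m layer a' ha'.le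
  have hWpos : ∀ v, 0 ≤ (star v ⬝ᵥ (W' *ᵥ v)).re := re_form_WGW_nonneg L M (k + 1) m layer a' ha'.le
  have hDG : ((gradT L M k)ᴴ * gradT L M k + WGW L M k m layer a') * GOmGW L M k m layer a' = 1 := by
    rw [← DpGW_eq_lap_add_WGW]; exact Matrix.mul_nonsing_inv _ hD
  have hD'G' : ((GradOp (fine (L * lev L k) M) ((L : ℂ) * ((lev L k : ℕ) : ℂ)))ᴴ
        * GradOp (fine (L * lev L k) M) ((L : ℂ) * ((lev L k : ℕ) : ℂ)) + W') * G' = 1 := by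
    have h : DpGW L M (k + 1) m layer a' * GOmGW L M (k + 1) m layer a' = 1 := Matrix.mul_nonsing_inv _ hD'
    rw [DpGW_eq_lap_add_WGW L M (k + 1) m layer a', gradT_succ L M k] at h
    exact h
  have hG'D' : G' * ((GradOp (fine (L * lev L k) M) ((L : ℂ) * ((lev L k : ℕ) : ℂ)))ᴴ
        * GradOp (fine (L * lev L k) M) ((L : ℂ) * ((lev L k : ℕ) : ℂ)) + W') = 1 := by
    have h : GOmGW L M (k + 1) m layer a' * DpGW L M (k + 1) m layer a' = 1 := Matrix.nonsing_inv_mul _ hD'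
    rw [DpGW_eq_lap_add_WGW L M (k + 1) m layer a', gradT_succ L M k] at h
    exact h
  have hG'n : ‖G'‖ ≤ (gamGW d m a')⁻¹ := hG'n
  have hW'n : ‖W'‖ ≤ wGWc L m a' := hW'n
  have hcol := opNorm_columns_twoLevel_le (lev L k) L M (WGW L M k m layer a') W'
    hg0 hw0 hw0 hWJ hWpos0 hWpos hDG hD'G' hG'D' hGn hG'n hWn hW'n
  have hcol' : ‖gradT L M (k + 1) * GOmGW L M (k + 1) m layer a' * J0pcT L M k
      - JGW L M k * (gradT L M k * GOmGW L M k m layer a')‖ ≤ CbGW d L m a' * (((lev L k : ℕ) : ℝ))⁻¹ := by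
    rw [gradT_succ]; exact hcol
  have e : BhGWL L M k m layer a' hk - JGW L M k * BhGW L M k m layer a'
      = (gradT L M (k + 1) * GOmGW L M (k + 1) m layer a' * J0pcT L M k
          - JGW L M k * (gradT L M k * GOmGW L M k m layer a')) * (QsGWn L M k m layer)ᴴ := by
    rw [BhGWL_eq L M k m layer a' hk, BhGW_eq, Matrix.sub_mul, Matrix.mul_assoc (JGW L M k)]
  rw [e, ← inv_lev_eq L k]
  calc ‖(gradT L M (k + 1) * GOmGW L M (k + 1) m layer a' * J0pcT L M k
          - JGW L M k * (gradT L M k * GOmGW L M k m layer a')) * (QsGWn L M k m layer)ᴴ‖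
      ≤ ‖gradT L M (k + 1) * GOmGW L M (k + 1) m layer a' * J0pcT L M k
          - JGW L M k * (gradT L M k * GOmGW L M k m layer a')‖ * ‖(QsGWn L M k m layer)ᴴ‖ := Matrix.l2_opNorm_mul _ _
    _ ≤ CbGW d L m a' * (((lev L k : ℕ) : ℝ))⁻¹ * 1 :=
        mul_le_mul hcol' (opNorm_QsGWn_conjTranspose_le L M k m layer) (norm_nonneg _)
          (mul_nonneg (CbGW_nonneg L m a' ha') (inv_nonneg.mpr (Nat.cast_nonneg _)))
    _ = CbGW d L m a' * (((lev L k : ℕ) : ℝ))⁻¹ := mul_one _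

/-- the same at any rate `θ ≥ L⁻¹` (the form `hinjK_GW_of_local` / `towerLimitRate_GW_of_GWB` display). [folklore] -/
theorem hB_GW_of_le (hlay : ∀ y, layer y ≤ m) (ha' : 0 < a') {θ : ℝ} (hθ : (L : ℝ)⁻¹ ≤ θ) (k : ℕ) (hk : m ≤ k) :
    ‖BhGWL L M k m layer a' hk - JGW L M k * BhGW L M k m layer a'‖ ≤ CbGW d L m a' * θ ^ k :=
  (hB_GW L M k m layer a' hk hlay ha').trans (mul_le_mul_of_nonneg_left
    (pow_le_pow_left₀ (inv_nonneg.mpr (Nat.cast_nonneg L)) hθ k) (CbGW_nonneg L m a' ha'))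

end Main

end Summit.QuantumFields.BalabanUV.T4Continuum.GradedWellColumnsTwoLevel

end
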